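import Summits.KontsevichZagierPeriods.KontsevichZagierPeriods.Theses.InequalityCost
import Summits.KontsevichZagierPeriods.KontsevichZagierPeriods.Theorems.StandardPartsSpAeCongruence
import Literature.NumberTheory.Transcendental.KZTameMoveFamily

/-!
# Crux `InequalityCost.TameNLLimit` (stmt-KontsevichZagierPeriods-8989) — birth skeleton (`Lines/birth.lean`)

Registered skeleton (planner, mode `skeleton-register`, route re-audit bin REPAIRABLE) for the rank-4 crux
`Summit.KontsevichZagierPeriods.KontsevichZagierPeriods.Theses.InequalityCost.TameNLLimit` (TAME CLOSURE FOR
RULE 3) of route-KontsevichZagierPeriods-InequalityCost: three named stubs and the kernel-checked composition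
`TameNLLimit_of : TameNLLimit`, whose body is the registered implication
`<stub_limitConfig> → <stub_derivOffThinSet> → <stub_piecewiseNL> → TameNLLimit` (a `suffices`, sorry-free)
applied to the three stubs by name (shape required by `#h21_check_skeleton`: conclusion = crux BY NAME, no
unregistered hypotheses, sorries only inside `stub_*`).

## The line: LIMIT ⇒ PIECEWISE NEWTON–LEIBNIZ ⇒ RE-SPLIT

The crux: a tame `ℚ`-semialgebraic family, over `t ∈ (0,1)`, of instances of KZ's rule 3 (bands
`B_t = {(x,s) | x ∈ T_t, a_t x ≤ s ≤ b_t x}`, primitives `F_t` continuous on closed fibres with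
`∂F_t/∂s = G_t` on open fibres, `H_t = F_t(b_t) − F_t(a_t)`), whose band side `(B_t, G_t)` and base side
`(T_t, H_t)` converge in `L¹` to representations `r₀`, `r₀'`, has `KZ.Equivalent r₀ r₀'`. The hypotheses are,
clause by clause, a `KZ.RawNLFamilyOn (Set.Ioo 0 1) n` (`Literature/…/KZTameMoveFamily.lean`, the route's
definition request D1) with `RawFamily.IsTame` bounds and two `RawFamily.HasL1Limit` clauses
(`hasL1Limit_iff` is `Iff.rfl`); `TameNLLimit_of` does exactly this repackaging and then chains:

1. `stub_limitConfig` (HARDEST, size L; o-minimal limits + dominated convergence + equi-Lipschitz fibres):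
   the two `L¹`-limits are, up to a.e.-congruence of extended integrands, an INTEGRATED BAND CONFIGURATION:
   a band representation `R` over a base `R'` with `ℚ`-semialgebraic edges `a₀ ≤ b₀` and a primitive `F₀`,
   `ℚ`-semialgebraic on the closed limit band, continuous on every closed fibre, with
   `F₀(x,s') − F₀(x,s) = ∫_s^{s'} R.integrand (x,σ) dσ` on closed fibres and `R'.integrand = F₀(b₀) − F₀(a₀)`.
   (Pointwise limits at `0⁺` exist by o-minimal monotonicity and are `∅`-definable, hence `ℚ`-semialgebraic;
   `|G| ≤ N` makes every `F_t(x,·)` `N`-Lipschitz, so `F_t(x,b_t x) → F̄₀(x,b₀ x)`; FTC on `[s,s'] ⊂ (a_t x, b_t x)`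
   and dominated convergence give the integral identity; where `a₀ = b₀` both sides vanish.) What is NOT
   claimed: that `F₀(x,·)` is differentiable with derivative `R.integrand` — false in general
   (`F_t = √(s²+t²) → |s|`): this is the docstring's "G₀ only piecewise continuous".
2. `stub_derivOffThinSet` (size M; Tarski–Seidenberg + one-variable monotonicity + FTC-1): in an integrated
   band configuration the primitive HAS derivative `R.integrand (x,s)` at every point of the open fibre off a
   `ℚ`-semialgebraic exceptional set `D` with FINITE fibres (the fibrewise discontinuity locus of the
   semialgebraic integrand).
3. `stub_piecewiseNL` (size L; cylindrical decomposition + moves (1a), (1b), (3)): RULE 3 TOLERATES A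
   SEMIALGEBRAIC FINITE-FIBRE EXCEPTIONAL SET — a Newton–Leibniz configuration whose derivative clause holds
   only off such a `D` is still a KZ-equivalence `[band, g] ~ [base, F(b) − F(a)]` (re-split the band along the
   sections of a cylindrical decomposition adapted to `D`, rule 3 on each closed sub-band, telescope the base
   integrands by integrand additivity, discard graphs and bands over lower-dimensional cells as null
   representations). With `D = ∅` this is the printed rule (the sorry-free `example` after stub 3).

Then `r₀ ~ R` and `r₀' ~ R'` by the landed support item SpAeCongruence
(`Summit.KontsevichZagierPeriods.StandardParts.of_sub_of_mem_relations_of_indicator_ae_eq`,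
Theorems/StandardPartsSpAeCongruence.lean) and `KZ.Equivalent.trans/symm` close the chain
`r₀ ~ R ~ R' ~ r₀'`. No `Disproof.lean` / `Negative/` lemma exists for this crux (`ledger crux ls`: no
workfiles at registration), so there is no `_false_without_` obstruction to honour; the line USES the
tameness bounds `|G|, |F| ≤ N` (in `stub_limitConfig`: equi-Lipschitz fibres and dominated convergence) and
`a_t ≤ b_t` (band shape of the limit), i.e. exactly the hypotheses the route header flags as load-bearing.
-/

noncomputable section

open MeasureTheory Set Filter
open scoped Topology

namespace Summit.KontsevichZagierPeriods.KontsevichZagierPeriods.Cruxes.TameNLLimit.Birth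

open Literature.NumberTheory.Transcendental Literature.NumberTheory.Transcendental.KZ
open Literature.ModelTheory.ExponentialFields (IsSemialgebraic)
open Summit.KontsevichZagierPeriods.KontsevichZagierPeriods.Theses.InequalityCost (TameNLLimit)
open Summit.KontsevichZagierPeriods.StandardParts (of_sub_of_mem_relations_of_indicator_ae_eq)

/-- **STUB 1 (`stub_limitConfig`, hardest, size L) — the `L¹`-limits of a tame Newton–Leibniz family
form an integrated band configuration, up to a.e.-congruence.** For a raw `ℚ`-semialgebraic family `M` of
rule-3 instances over `(0,1)` (`KZ.RawNLFamilyOn`), tame with bound `N` (band and base in `[−N,N]`,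
`|G|, |H|, |F| ≤ N`), whose band side tends to `r₀` and base side to `r₀'` in `L¹` as `t → 0⁺`, there are a
band representation `R` over a base representation `R'` with `ℚ`-semialgebraic edges `a ≤ b` and a
primitive `F`, `ℚ`-semialgebraic on `R.domain`, continuous on each closed fibre, satisfying the INTEGRATED
rule-3 identity `F(x,s') − F(x,s) = ∫_s^{s'} R.integrand (x,σ) dσ` on closed fibres and
`R'.integrand x = F(x,b x) − F(x,a x)`, such that the extended integrands of `r₀`, `R` (resp. `r₀'`, `R'`)
agree a.e. (Limit base `{x | eventually x ∈ T_t}`, limit edges and integrands = pointwise limits at `0⁺`,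
`∅`-definable by o-minimality hence `ℚ`-semialgebraic; primitive = continuous extension of `lim F_t` from the
open limit fibre, using that `|G| ≤ N` makes `F_t(x,·)` `N`-Lipschitz; dominated convergence throughout.)
[van den Dries 1998, Ch. 3 (1.2), (1.5)–(1.6); Kontsevich–Zagier 2001, §1.2 rule (3)] -/
theorem stub_limitConfig :
    ∀ ⦃n : ℕ⦄ (N : ℕ) (M : KZ.RawNLFamilyOn (Set.Ioo (0:ℝ) 1) n)
      (r₀ : KZ.IntegralRep (n + 1)) (r₀' : KZ.IntegralRep n),
      M.band.IsTame N → (∀ z ∈ M.band.total, |M.prim z| ≤ N) → M.base.IsTame N →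
      M.band.HasL1Limit r₀ → M.base.HasL1Limit r₀' →
      ∃ (R : KZ.IntegralRep (n + 1)) (R' : KZ.IntegralRep n) (a b : (Fin n → ℝ) → ℝ)
        (F : (Fin (n + 1) → ℝ) → ℝ),
        IsSemialgebraicFunOn ℚ R'.domain a ∧ IsSemialgebraicFunOn ℚ R'.domain b ∧
        IsSemialgebraicFunOn ℚ R.domain F ∧
        (∀ x ∈ R'.domain, a x ≤ b x) ∧
        R.domain = {z : Fin (n + 1) → ℝ | Fin.init z ∈ R'.domain ∧ a (Fin.init z) ≤ z (Fin.last n) ∧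
          z (Fin.last n) ≤ b (Fin.init z)} ∧
        (∀ x ∈ R'.domain, ContinuousOn (fun s : ℝ => F (Fin.snoc x s)) (Set.Icc (a x) (b x))) ∧
        (∀ x ∈ R'.domain, ∀ s ∈ Set.Icc (a x) (b x), ∀ s' ∈ Set.Icc (a x) (b x),
          F (Fin.snoc x s') - F (Fin.snoc x s) = ∫ σ in s..s', R.integrand (Fin.snoc x σ)) ∧
        (∀ x ∈ R'.domain, R'.integrand x = F (Fin.snoc x (b x)) - F (Fin.snoc x (a x))) ∧
        r₀.domain.indicator r₀.integrand =ᵐ[MeasureTheory.volume] R.domain.indicator R.integrand ∧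
        r₀'.domain.indicator r₀'.integrand =ᵐ[MeasureTheory.volume] R'.domain.indicator R'.integrand := by
  sorry

/-- **STUB 2 (`stub_derivOffThinSet`, size M) — in an integrated band configuration the primitive is
differentiated by the integrand off a semialgebraic finite-fibre set.** If `R` is a representation on the
closed band of `ℚ`-semialgebraic edges `a, b` over a `ℚ`-semialgebraic base `τ`, `F` is `ℚ`-semialgebraic on
the band and `F(x,s') − F(x,s) = ∫_s^{s'} R.integrand (x,σ) dσ` on closed fibres, then there is a
`ℚ`-semialgebraic `D ⊆ ℝⁿ⁺¹` with finite fibres over `τ` such that `s ↦ F(x,s)` has derivative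
`R.integrand (x,s)` at every `s ∈ (a x, b x)` with `(x,s) ∉ D`. (`D` = the fibrewise discontinuity locus of
`R.integrand` inside the open band: first-order in `ℚ`-semialgebraic data, hence `ℚ`-semialgebraic by
Tarski–Seidenberg; each fibre is the discontinuity set of a semialgebraic function of one variable, finite by
the monotonicity theorem; at a continuity point the integrand is bounded and measurable nearby and FTC-1
differentiates the integral.) [van den Dries 1998, Ch. 3 (1.2); Bochnak–Coste–Roy 1998, Thm. 2.2.1;
Basu–Pollack–Roy 2006, Prop. 3.22] -/
theorem stub_derivOffThinSet :
    ∀ ⦃n : ℕ⦄ (R : KZ.IntegralRep (n + 1)) (τ : Set (Fin n → ℝ)) (a b : (Fin n → ℝ) → ℝ)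
      (F : (Fin (n + 1) → ℝ) → ℝ),
      IsSemialgebraic ℚ τ → IsSemialgebraicFunOn ℚ τ a → IsSemialgebraicFunOn ℚ τ b →
      IsSemialgebraicFunOn ℚ R.domain F →
      R.domain = {z : Fin (n + 1) → ℝ | Fin.init z ∈ τ ∧ a (Fin.init z) ≤ z (Fin.last n) ∧
          z (Fin.last n) ≤ b (Fin.init z)} →
      (∀ x ∈ τ, ∀ s ∈ Set.Icc (a x) (b x), ∀ s' ∈ Set.Icc (a x) (b x),
          F (Fin.snoc x s') - F (Fin.snoc x s) = ∫ σ in s..s', R.integrand (Fin.snoc x σ)) →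
      ∃ D : Set (Fin (n + 1) → ℝ), IsSemialgebraic ℚ D ∧
        (∀ x ∈ τ, Set.Finite {s : ℝ | (Fin.snoc x s : Fin (n + 1) → ℝ) ∈ D}) ∧
        ∀ x ∈ τ, ∀ s ∈ Set.Ioo (a x) (b x), (Fin.snoc x s : Fin (n + 1) → ℝ) ∉ D →
          HasDerivAt (fun σ : ℝ => F (Fin.snoc x σ)) (R.integrand (Fin.snoc x s)) s := by
  sorry

/-- **STUB 3 (`stub_piecewiseNL`, size L) — rule 3 tolerates a semialgebraic finite-fibre exceptional
set.** Data as in `KZ.newtonLeibnizRel` (band representation `R` over base representation `R'` between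
`ℚ`-semialgebraic edges `a ≤ b`, primitive `F` `ℚ`-semialgebraic on the band and continuous on each closed
fibre, `R'.integrand = F(b) − F(a)`), except that `∂F/∂s = R.integrand` is asked only at points of the open
fibres OFF a `ℚ`-semialgebraic set `D` with finite fibres over the base; still `KZ.Equivalent R R'`.
(Cylindrical decomposition of `ℝⁿ⁺¹` adapted to the band, the open band, `D ∩` open band and the base
cylinder (tree: `IsSemialgebraic.exists_cylindricalDecomposition_holds`); over a cell `S ⊆ base` the
exceptional points are graphs of sections `a = η₀ < η₁ < ⋯ < η_k < η_{k+1} = b`; the closed sub-bands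
`[η_i, η_{i+1}]` are honest rule-3 instances with base integrands `F(η_{i+1}) − F(η_i)` (integrable: dominated
a.e. by the fibre integral of `|R.integrand|`, Tonelli), which telescope to `F(b) − F(a)` by integrand
additivity; graphs and pieces over lower-dimensional cells are null, hence relations
(`KZ.of_mem_relations_of_volume_eq_zero`); domain additivity reassembles band and base.)
[Kontsevich–Zagier 2001, §1.2 rules (1), (3); Basu–Pollack–Roy 2006, Thm. 5.6 / Cor. 5.7] -/
theorem stub_piecewiseNL :
    ∀ ⦃n : ℕ⦄ (R : KZ.IntegralRep (n + 1)) (R' : KZ.IntegralRep n) (a b : (Fin n → ℝ) → ℝ)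
      (F : (Fin (n + 1) → ℝ) → ℝ) (D : Set (Fin (n + 1) → ℝ)),
      IsSemialgebraicFunOn ℚ R'.domain a → IsSemialgebraicFunOn ℚ R'.domain b →
      IsSemialgebraicFunOn ℚ R.domain F → IsSemialgebraic ℚ D →
      (∀ x ∈ R'.domain, a x ≤ b x) →
      R.domain = {z : Fin (n + 1) → ℝ | Fin.init z ∈ R'.domain ∧ a (Fin.init z) ≤ z (Fin.last n) ∧
          z (Fin.last n) ≤ b (Fin.init z)} →
      (∀ x ∈ R'.domain, ContinuousOn (fun s : ℝ => F (Fin.snoc x s)) (Set.Icc (a x) (b x))) →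
      (∀ x ∈ R'.domain, Set.Finite {s : ℝ | (Fin.snoc x s : Fin (n + 1) → ℝ) ∈ D}) →
      (∀ x ∈ R'.domain, ∀ s ∈ Set.Ioo (a x) (b x), (Fin.snoc x s : Fin (n + 1) → ℝ) ∉ D →
          HasDerivAt (fun σ : ℝ => F (Fin.snoc x σ)) (R.integrand (Fin.snoc x s)) s) →
      (∀ x ∈ R'.domain, R'.integrand x = F (Fin.snoc x (b x)) - F (Fin.snoc x (a x))) →
      KZ.Equivalent R R' := by
  sorry

/- Sanity for STUB 3 (sorry-free, `k = 0` case): with NO exceptional points the piecewise rule-3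
configuration is one instance of the printed rule, `[R] − [R'] ∈ KZ.newtonLeibnizRel ⊆ KZ.relations`; so the
stub is inhabited-in-kind and its content is exactly the re-splitting along `D`.
[Kontsevich–Zagier 2001, §1.2 rule (3)] -/
example {n : ℕ} (R : KZ.IntegralRep (n + 1)) (R' : KZ.IntegralRep n)
    (a b : (Fin n → ℝ) → ℝ) (F : (Fin (n + 1) → ℝ) → ℝ)
    (ha : IsSemialgebraicFunOn ℚ R'.domain a) (hb : IsSemialgebraicFunOn ℚ R'.domain b)
    (hF : IsSemialgebraicFunOn ℚ R.domain F) (hab : ∀ x ∈ R'.domain, a x ≤ b x)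
    (hdom : R.domain = {z : Fin (n + 1) → ℝ | Fin.init z ∈ R'.domain ∧ a (Fin.init z) ≤ z (Fin.last n) ∧
        z (Fin.last n) ≤ b (Fin.init z)})
    (hcont : ∀ x ∈ R'.domain, ContinuousOn (fun s : ℝ => F (Fin.snoc x s)) (Set.Icc (a x) (b x)))
    (hder : ∀ x ∈ R'.domain, ∀ s ∈ Set.Ioo (a x) (b x),
        HasDerivAt (fun σ : ℝ => F (Fin.snoc x σ)) (R.integrand (Fin.snoc x s)) s)
    (hbase : ∀ x ∈ R'.domain, R'.integrand x = F (Fin.snoc x (b x)) - F (Fin.snoc x (a x))) :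
    KZ.Equivalent R R' :=
  newtonLeibnizRel_subset_relations ⟨n, R, R', a, b, F, hF, ha, hb, hab, hdom, hcont, hder, hbase, rfl⟩

/-- **Composition (kernel-checked): the crux BY NAME from the three stubs.** The `suffices` line is the
registered implication `<stub_limitConfig> → <stub_derivOffThinSet> → <stub_piecewiseNL> → TameNLLimit` (a
closed term, no `sorry` of its own), applied to the three named stubs. Proof of the implication: package the
hypotheses of `TameNLLimit` as a raw Newton–Leibniz family `M : KZ.RawNLFamilyOn (Set.Ioo 0 1) n` with its
tameness bounds and the two `L¹`-limit clauses (`KZ.RawFamily.hasL1Limit_iff`, definitional); stub 1 gives the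
integrated band configuration `(R, R', a₀, b₀, F₀)` a.e.-congruent to `(r₀, r₀')`; stub 2 its exceptional set
`D`; stub 3 `R ~ R'`; the landed support item SpAeCongruence
(`Summit.KontsevichZagierPeriods.StandardParts.of_sub_of_mem_relations_of_indicator_ae_eq`) gives `r₀ ~ R`,
`r₀' ~ R'`; conclude by `KZ.Equivalent.trans/symm`. [Kontsevich–Zagier 2001, §1.2] -/
theorem TameNLLimit_of : TameNLLimit := by
  suffices key :
      (∀ ⦃n : ℕ⦄ (N : ℕ) (M : KZ.RawNLFamilyOn (Set.Ioo (0:ℝ) 1) n)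
        (r₀ : KZ.IntegralRep (n + 1)) (r₀' : KZ.IntegralRep n),
        M.band.IsTame N → (∀ z ∈ M.band.total, |M.prim z| ≤ N) → M.base.IsTame N →
        M.band.HasL1Limit r₀ → M.base.HasL1Limit r₀' →
        ∃ (R : KZ.IntegralRep (n + 1)) (R' : KZ.IntegralRep n) (a b : (Fin n → ℝ) → ℝ)
        (F : (Fin (n + 1) → ℝ) → ℝ),
        IsSemialgebraicFunOn ℚ R'.domain a ∧ IsSemialgebraicFunOn ℚ R'.domain b ∧
        IsSemialgebraicFunOn ℚ R.domain F ∧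
        (∀ x ∈ R'.domain, a x ≤ b x) ∧
        R.domain = {z : Fin (n + 1) → ℝ | Fin.init z ∈ R'.domain ∧ a (Fin.init z) ≤ z (Fin.last n) ∧
          z (Fin.last n) ≤ b (Fin.init z)} ∧
        (∀ x ∈ R'.domain, ContinuousOn (fun s : ℝ => F (Fin.snoc x s)) (Set.Icc (a x) (b x))) ∧
        (∀ x ∈ R'.domain, ∀ s ∈ Set.Icc (a x) (b x), ∀ s' ∈ Set.Icc (a x) (b x),
          F (Fin.snoc x s') - F (Fin.snoc x s) = ∫ σ in s..s', R.integrand (Fin.snoc x σ)) ∧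
        (∀ x ∈ R'.domain, R'.integrand x = F (Fin.snoc x (b x)) - F (Fin.snoc x (a x))) ∧
        r₀.domain.indicator r₀.integrand =ᵐ[MeasureTheory.volume] R.domain.indicator R.integrand ∧
        r₀'.domain.indicator r₀'.integrand =ᵐ[MeasureTheory.volume] R'.domain.indicator R'.integrand) →
      (∀ ⦃n : ℕ⦄ (R : KZ.IntegralRep (n + 1)) (τ : Set (Fin n → ℝ)) (a b : (Fin n → ℝ) → ℝ)
        (F : (Fin (n + 1) → ℝ) → ℝ),
        IsSemialgebraic ℚ τ → IsSemialgebraicFunOn ℚ τ a → IsSemialgebraicFunOn ℚ τ b →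
        IsSemialgebraicFunOn ℚ R.domain F →
        R.domain = {z : Fin (n + 1) → ℝ | Fin.init z ∈ τ ∧ a (Fin.init z) ≤ z (Fin.last n) ∧
          z (Fin.last n) ≤ b (Fin.init z)} →
        (∀ x ∈ τ, ∀ s ∈ Set.Icc (a x) (b x), ∀ s' ∈ Set.Icc (a x) (b x),
          F (Fin.snoc x s') - F (Fin.snoc x s) = ∫ σ in s..s', R.integrand (Fin.snoc x σ)) →
        ∃ D : Set (Fin (n + 1) → ℝ), IsSemialgebraic ℚ D ∧
        (∀ x ∈ τ, Set.Finite {s : ℝ | (Fin.snoc x s : Fin (n + 1) → ℝ) ∈ D}) ∧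
        ∀ x ∈ τ, ∀ s ∈ Set.Ioo (a x) (b x), (Fin.snoc x s : Fin (n + 1) → ℝ) ∉ D →
          HasDerivAt (fun σ : ℝ => F (Fin.snoc x σ)) (R.integrand (Fin.snoc x s)) s) →
      (∀ ⦃n : ℕ⦄ (R : KZ.IntegralRep (n + 1)) (R' : KZ.IntegralRep n) (a b : (Fin n → ℝ) → ℝ)
        (F : (Fin (n + 1) → ℝ) → ℝ) (D : Set (Fin (n + 1) → ℝ)),
        IsSemialgebraicFunOn ℚ R'.domain a → IsSemialgebraicFunOn ℚ R'.domain b →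
        IsSemialgebraicFunOn ℚ R.domain F → IsSemialgebraic ℚ D →
        (∀ x ∈ R'.domain, a x ≤ b x) →
        R.domain = {z : Fin (n + 1) → ℝ | Fin.init z ∈ R'.domain ∧ a (Fin.init z) ≤ z (Fin.last n) ∧
          z (Fin.last n) ≤ b (Fin.init z)} →
        (∀ x ∈ R'.domain, ContinuousOn (fun s : ℝ => F (Fin.snoc x s)) (Set.Icc (a x) (b x))) →
        (∀ x ∈ R'.domain, Set.Finite {s : ℝ | (Fin.snoc x s : Fin (n + 1) → ℝ) ∈ D}) →
        (∀ x ∈ R'.domain, ∀ s ∈ Set.Ioo (a x) (b x), (Fin.snoc x s : Fin (n + 1) → ℝ) ∉ D →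
          HasDerivAt (fun σ : ℝ => F (Fin.snoc x σ)) (R.integrand (Fin.snoc x s)) s) →
        (∀ x ∈ R'.domain, R'.integrand x = F (Fin.snoc x (b x)) - F (Fin.snoc x (a x))) →
        KZ.Equivalent R R') →
      TameNLLimit from key stub_limitConfig stub_derivOffThinSet stub_piecewiseNL
  intro hLim hThin hNL n N B T G F H a b r₀ r₀' hBsa hTsa hG hF hH ha hb hBtame hTtame hfib hlim hlim'
  -- package the hypotheses as a raw ℚ-semialgebraic family of rule-3 instances over (0,1)
  let band : KZ.RawFamily (n + 1) :=
    { total := B, integrand := G, isSemialgebraic_total := hBsa, isSemialgebraicFunOn_integrand := hG }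
  let base : KZ.RawFamily n :=
    { total := T, integrand := H, isSemialgebraic_total := hTsa, isSemialgebraicFunOn_integrand := hH }
  let M : KZ.RawNLFamilyOn (Set.Ioo (0:ℝ) 1) n :=
    { band := band
      base := base
      prim := F
      lower := a
      upper := b
      isSemialgebraicFunOn_prim := hF
      isSemialgebraicFunOn_lower := ha
      isSemialgebraicFunOn_upper := hb
      lower_le_upper := fun t ht x hx => (hfib t ht).1 x hx
      fibre_band := fun t ht => (hfib t ht).2.1
      continuousOn := fun t ht x hx => (hfib t ht).2.2.1 x hx
      hasDerivAt := fun t ht x hx s hs => (hfib t ht).2.2.2.1 x hx s hs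
      base_eq := fun t ht x hx => (hfib t ht).2.2.2.2 x hx }
  have hMband : M.band.IsTame N := fun z hz => ⟨(hBtame z hz).1, (hBtame z hz).2.1⟩
  have hMprim : ∀ z ∈ M.band.total, |M.prim z| ≤ N := fun z hz => (hBtame z hz).2.2
  have hMbase : M.base.IsTame N := fun z hz => hTtame z hz
  have hl : M.band.HasL1Limit r₀ := (KZ.RawFamily.hasL1Limit_iff M.band r₀).2 hlim
  have hl' : M.base.HasL1Limit r₀' := (KZ.RawFamily.hasL1Limit_iff M.base r₀').2 hlim'
  -- stub 1: the integrated band configuration of the limit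
  obtain ⟨R, R', a₀, b₀, F₀, ha₀, hb₀, hF₀, hab, hdom, hcont, hint, hbase, hae, hae'⟩ :=
    hLim N M r₀ r₀' hMband hMprim hMbase hl hl'
  -- stub 2: the exceptional set
  obtain ⟨D, hD, hfin, hder⟩ :=
    hThin R R'.domain a₀ b₀ F₀ R'.isSemialgebraic_domain ha₀ hb₀ hF₀ hdom hint
  -- stub 3: piecewise Newton–Leibniz
  have e₂ : KZ.Equivalent R R' :=
    hNL R R' a₀ b₀ F₀ D ha₀ hb₀ hF₀ hD hab hdom hcont hfin hder hbase
  -- a.e.-congruence (landed support item SpAeCongruence) and transitivity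
  have e₁ : KZ.Equivalent r₀ R := of_sub_of_mem_relations_of_indicator_ae_eq r₀ R hae
  have e₃ : KZ.Equivalent r₀' R' := of_sub_of_mem_relations_of_indicator_ae_eq r₀' R' hae'
  exact e₁.trans (e₂.trans e₃.symm)

end Summit.KontsevichZagierPeriods.KontsevichZagierPeriods.Cruxes.TameNLLimit.Birth

end
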